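import Literature.NumberTheory.Automorphic.Liu2021.SplitPlaceOscillatorModelQuadExtPackage   -- ★ p816652: the μ-tied split model of the CM package
import Literature.NumberTheory.Automorphic.Liu2021.SplitPlaceHeckeEigenvaluesAtLine           -- ★ junction `congrW_undoubledSplittings_cmFinLocalFamily_s`
import Summits.HodgeConjecture.CorCM.B01.Transposition.Item6OmegaChiSplitting                  -- ★ B01 `chiLocalSplittingsD`
import Summits.HodgeConjecture.HodgeConjecture.Theorems.F0P2gStubNSIOfCore                      -- ★ p813543: `gram_realDiagonal_TW_eq_diagonal`
import Literature.NumberTheory.Automorphic.Liu2021.Def411IrreducibleOfLemD1AsPrinted            -- ★ `localCharOfCenter` API, `reindex_kronecker_JW_hermitian`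
import HarnessLib

/-!
# FLOOR-0 P2 — PKΠ RUNG 4, row GRD-(S): LIU'S LOCAL THETA TYPE AT A SPLIT PLACE IS `Ind_{Q_{n'-1,1}}^{GL_{n'}(L_w)}((θ_w ∘ det) ⊠ χ′ θ_w^{1-n'})`
# — the `χ_W`-coinvariants of the `θ`-attached oscillator representation (★ B01 `chiLocalSplittingsD`), read on `GL_{n'}(L_w)`

Cell hodgecm-mathlib (D-0151), FLOOR 0, programme P2 (theta ∕ `hdictE`); crux item H413 = stmt-HodgeConjecture-24833 (`HCCMUnconditional.H413`);
sub-line `Cruxes/H413/Lines/F0_P2PKPiRung4.lean` (F0P2-plan (g6)), row GRD-(S) (F0P2-p01 (g5)).  THEOREMS ONLY (no `def`, no instance, no notation, no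
named fact, no `sorry`); never imports a `Cruxes/…/Lines` module; `--supports stmt-HodgeConjecture-24833 --as helper`.  HC_CM is proved only modulo the
printed citations until rung 0 closes; this file discharges none — it instantiates ★ p816652 (`SplitPlaceOscillatorModelQuadExtPackage`, the μ-tied
split model, `ν = θ_w`) at the section of PKΠ's local theta type.

* §1 `chiLocalSplittingsD_s` — THE JUNCTION: the section at `v` of the `θ`-attached family of local splittings (★ B01 `OmegaChiSplitting.chiLocalSplittingsD
  ⟨L⟩ e₁ dV hdV hdV0 θ hθ ε`) IS the tree's CM package `localSplittingCM L n' … θ hθ v` at the Gram datum `gram L⁺ e₁ (realDiagonal dV) (T_W ε)`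
  (★ `congrW_undoubledSplittings_cmFinLocalFamily_s`, `subst; rfl`).
* §2 **`areIsomorphicRep_chiCoinv_chiLocalSplittingsD_split`** — for a CM field `L` (`c̄ ≠ 1`), `n' ≥ 2`, a frame `(e₁, dV)`, a unitary splitting character
  `θ` (`IsSplittingChar L 1 θ`; in PKΠ `θ = toHeckeCharacter μ`), a line `ε`, a unitary continuous `χ₁ : U(1)(𝔸_{L⁺,f}) → ℂˣ`, a place `v` of `L⁺` SPLIT in
  `L`, ANY `w ∣ v` with `c̄ • w ≠ w`, and the `w`-reading `χ′` of the centre character `localCharOfCenter … (J_W ε) … χ₁ v` (`χ′(z_w) = χ_{1,v}(z)`):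
  the representation of `U(J)(L⁺_v)`, `J = reindex e₁ (diag dV ⊗ J_W ε)`, on the `χ_{1,v}`-coinvariants of `ω_v = (chiLocalSplittingsD … θ … ε).omegaLoc v`
  (THE TERM of PKΠ's `X_v(μ, ε, χ)` before `localLineInl`, with `χ.1 ↦ χ₁`), read on `GL_{n'}(L_w)` along `(localPiSplitEquiv J)⁻¹`, is `AreIsomorphicRep` to
  `parabolicIndGL L_w (lastBlockLabel n') (𝟙.twist (maxParabolicLeviChar n' θ_w (χ′ · θ_w^{1-n'})))` — [Liu2021, App. D, proof of Lem. D.1 ¶1] «`ω(μ,ε,χ) ≅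
  Ind_{Q_{n-1,1}}((ν∘det) ⊠ χν^{1-n})`, `μ = ν ⊠ ν⁻¹`» with `ν = θ_w` EXPLICIT.  Proof: §1 + ★ `splitPlace_chiCoinv_iso_parabolicIndGL_undoubleLoc_localSplittingDatumQuadExt`
  (`T₀ = gram …` is diagonal: ★ `gram_realDiagonal_TW_eq_diagonal`; `localSplittingCM = undoubleLoc (localSplittingDatumQuadExt …).localSplitting` by `rfl`
  at the Borel σ-algebra and `Measure.addHaar`; `χ_{1,v}` unitary ∕ continuous by ★ `norm_localCharOfCenter` ∕ `continuous_coe_localCharOfCenter`).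
With ★ p816908 `F0P2iGRDSplitTransport.nonempty_equiv_comp_localLineInl_localCongr_symm` (n' = 3) this gives `X_v(μ,ε,χ) ∘ localLineInl ∘ κ_v⁻¹ ≃
Ind((μ_w∘det₂) ⊠ χ′μ_w⁻²) ∘ localPiSplitEquiv H` — the split member `i_G(ξ_w) ∘ cmSplitEquiv` of Rogawski's packet [Rogawski1990, Lemma 4.13.1 (b)] as soon as
`ν₀ = μ_w` and `χ′′ = χ′ μ_w⁻²` (the dictionary (5.1.1) of [GelbartRogawski1991] at a split place).

## References
* [Liu2021] Y. Liu, Camb. J. Math. 9 (2021) = arXiv:2102.11518: App. D §D.1 Steps 1–3 (l. 5213–5224), proof of Lemma D.1, first paragraph (p. 126, l. 5241).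
* [MoeglinVignerasWaldspurger1987] LNM 1291: Chap. 3 §III.1, §III.7 a).  [Kudla1994] Israel J. Math. 87: §3 Thm 3.1.  [HarrisKudlaSweet1996] J. AMS 9: §1 (1.15)–(1.16).
* [GelbartRogawski1991] Invent. Math. 105: §3.1 Prop. 3.1.1 p. 455, (5.1.1) p. 465.  [Rogawski1990] Ann. of Math. Stud. 123: Lemma 4.13.1 (b), §13.3 p. 201.
-/

set_option autoImplicit false
-- the mandated namespace has the single-problem summit's repeated segment (`HodgeConjecture.HodgeConjecture`)
set_option linter.dupNamespace false

noncomputable section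

open scoped Matrix Kronecker MatrixGroups
open NumberField IsDedekindDomain MeasureTheory
open Literature.NumberTheory Literature.NumberTheory.Automorphic Literature.NumberTheory.Automorphic.UnitaryGroup
open Literature.NumberTheory.Automorphic.IdeleClassGroup
open Literature.NumberTheory.Automorphic.Liu2021 Literature.NumberTheory.Automorphic.Liu2021.Def411WeilCarriers
open Literature.NumberTheory.Automorphic.Liu2021.Def411WeilCarriersDoubling
open Literature.NumberTheory.GelbartRogawski1991 Literature.NumberTheory.GelbartRogawski1991.UnitaryDualPair
open Literature.NumberTheory.GelbartRogawski1991.UnitaryDualPair.WeilCoinv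
open Literature.NumberTheory.GelbartRogawski1991.UnitaryDualPair.LocalSplitting
open Literature.NumberTheory.GelbartRogawski1991.GRConstruction
open Literature.RepresentationTheory Literature.RepresentationTheory.Liu2021
open Literature.RepresentationTheory.HeisenbergGroup (MpPsi)
open Literature.NumberTheory.GaloisRepresentations Literature.RepresentationTheory.HarrisKudlaSweet1996
open Summit.HodgeConjecture.CorCM.Transposition

namespace Summit.HodgeConjecture.HodgeConjecture.Cruxes.H413.F0P2iXvSplitModel

/-! ## §1 The junction -/

set_option synthInstance.maxHeartbeats 400000 in
set_option maxHeartbeats 8000000 in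
/-- **the section at `v` of the `θ`-attached family of local splittings IS `localSplittingCM L n' … θ hθ v`** at the Gram datum
`gram L⁺ e₁ (realDiagonal dV) (T_W ε)` (★ `congrW_undoubledSplittings_cmFinLocalFamily_s` at `dW := lineW L (T_W ε)`; `chiLocalSplittingsD` unfolds by `rfl`).
[cite: GelbartRogawski1991, §3.1 Prop. 3.1.1 p. 455] [cite: Liu2021, App. D §D.1 Step 2 (l. 5219)] -/
theorem chiLocalSplittingsD_s (L : Type) [Field L] [NumberField L] [IsCMField L] {n' : ℕ} (e₁ : Fin 3 × Fin 1 ≃ Fin n')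
    (dV : Fin 3 → L) (hdV : ∀ i, IsCMField.complexConj L (dV i) = dV i) (hdV0 : ∀ i, dV i ≠ 0)
    (θ : HeckeCharacter L) (hθ : IsSplittingChar L 1 θ) (ε : (↥(maximalRealSubfield L))ˣ)
    (v : HeightOneSpectrum (𝓞 ↥(maximalRealSubfield L))) :
    (OmegaChiSplitting.chiLocalSplittingsD ⟨L⟩ e₁ dV hdV hdV0 θ hθ ε).s v =
      localSplittingCM L n' (T₀ := gram ↥(maximalRealSubfield L) e₁ (realDiagonal L dV hdV) (TW ↥(maximalRealSubfield L) ε))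
        (isSymm_gram ↥(maximalRealSubfield L) e₁ (realDiagonal_isSymm L dV hdV) (isSymm_TW ↥(maximalRealSubfield L) ε))
        (isUnit_det_gram ↥(maximalRealSubfield L) e₁ (isUnit_det_realDiagonal L dV hdV hdV0) (isUnit_det_TW ↥(maximalRealSubfield L) ε))
        (reindex_kronecker_eq_gram_map ↥(maximalRealSubfield L) L e₁ (realDiagonal_map L dV hdV).symm (JW_eq ↥(maximalRealSubfield L) L ε))
        θ hθ v :=
  congrW_undoubledSplittings_cmFinLocalFamily_s L e₁ dV hdV hdV0 (lineW L (TW ↥(maximalRealSubfield L) ε))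
    (complexConj_lineW L (TW ↥(maximalRealSubfield L) ε))
    (lineW_ne_zero L (TW ↥(maximalRealSubfield L) ε) (isUnit_det_TW ↥(maximalRealSubfield L) ε))
    (realDiagonal_lineW L (TW ↥(maximalRealSubfield L) ε))
    (diagonal_lineW L (TW ↥(maximalRealSubfield L) ε) (JW_eq ↥(maximalRealSubfield L) L ε))
    (isSymm_TW ↥(maximalRealSubfield L) ε) (isUnit_det_TW ↥(maximalRealSubfield L) ε) (JW_eq ↥(maximalRealSubfield L) L ε) θ hθ v

/-! ## §2 The split model of Liu's local theta type -/

set_option synthInstance.maxHeartbeats 400000 in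
set_option maxHeartbeats 8000000 in
/-- **LIU'S LOCAL THETA TYPE AT A SPLIT PLACE IS `Ind_{Q_{n'-1,1}}^{GL_{n'}(L_w)}((θ_w ∘ det) ⊠ χ′ θ_w^{1-n'})`**: the `χ_{1,v}`-coinvariants of
`ω_v = (chiLocalSplittingsD ⟨L⟩ e₁ dV hdV hdV0 θ hθ ε).omegaLoc v` (PKΠ's `X_v` term with `χ.1 ↦ χ₁`, BEFORE `localLineInl`), read on `GL_{n'}(L_w)` along
`(localPiSplitEquiv J)⁻¹` at ANY `w ∣ v` split, are `AreIsomorphicRep` to the normalised induction of `(θ_w ∘ det_{n'-1}) ⊠ χ′ θ_w^{1-n'}` — ★ p816652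
`splitPlace_chiCoinv_iso_parabolicIndGL_undoubleLoc_localSplittingDatumQuadExt` at the junction §1 (`T₀` diagonal by ★ `gram_realDiagonal_TW_eq_diagonal`,
`localSplittingCM = undoubleLoc …` by `rfl` at `borel`∕`Measure.addHaar`, `χ_{1,v}` unitary∕continuous by ★ `norm_localCharOfCenter`∕`continuous_coe_localCharOfCenter`).
[cite: Liu2021, App. D, proof of Lemma D.1 (first paragraph), p. 126] [cite: MoeglinVignerasWaldspurger1987, Chap. 3 III.7 a)] [cite: Kudla1994, §3 Thm. 3.1]
[cite: HarrisKudlaSweet1996, §1 (1.15)–(1.16)] [cite: Rogawski1990, Lemma 4.13.1 (b)] -/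
theorem areIsomorphicRep_chiCoinv_chiLocalSplittingsD_split
    (L : Type) [Field L] [NumberField L] [IsCMField L] (hc1 : IsCMField.complexConj L ≠ 1) {n' : ℕ} (hn : 2 ≤ n')
    (e₁ : Fin 3 × Fin 1 ≃ Fin n') (dV : Fin 3 → L) (hdV : ∀ i, IsCMField.complexConj L (dV i) = dV i) (hdV0 : ∀ i, dV i ≠ 0)
    (θ : HeckeCharacter L) (hθ : IsSplittingChar L 1 θ) (hθu : θ.IsUnitary) (ε : (↥(maximalRealSubfield L))ˣ)
    (χ₁ : finAdelicOne (↥(maximalRealSubfield L)) L (IsCMField.complexConj L) →* ℂˣ)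
    (hχ₁u : ∀ u, ‖((χ₁ u : ℂˣ) : ℂ)‖ = 1) (hχ₁c : Continuous χ₁)
    (v : HeightOneSpectrum (𝓞 ↥(maximalRealSubfield L))) (w : PlacesOver L v)
    (hw : IsCMField.complexConj L • (w : HeightOneSpectrum (𝓞 L)) ≠ w)
    (hJh : ((Matrix.reindex e₁ e₁ (Matrix.diagonal dV ⊗ₖ JW (↥(maximalRealSubfield L)) L ε)).map (IsCMField.complexConj L))ᵀ =
      Matrix.reindex e₁ e₁ (Matrix.diagonal dV ⊗ₖ JW (↥(maximalRealSubfield L)) L ε))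
    (hJw : IsUnit (placeForm (Matrix.reindex e₁ e₁ (Matrix.diagonal dV ⊗ₖ JW (↥(maximalRealSubfield L)) L ε)) (w : HeightOneSpectrum (𝓞 L))))
    [LocallyCompactSpace (standardParabolicGL ((w : HeightOneSpectrum (𝓞 L)).adicCompletion L) (Zelevinsky1980.lastBlockLabel n'))]
    (χ' : ((w : HeightOneSpectrum (𝓞 L)).adicCompletion L)ˣ →* ℂˣ)
    (hχ' : ∀ z : localPi L (IsCMField.complexConj L) 1 (JW (↥(maximalRealSubfield L)) L ε) v,
      χ' (Matrix.GeneralLinearGroup.det ((z : LocalGLPi L 1 v) w)) =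
        localCharOfCenter (↥(maximalRealSubfield L)) L (IsCMField.complexConj L) (JW (↥(maximalRealSubfield L)) L ε)
          (JW_apply_ne_zero (↥(maximalRealSubfield L)) L ε) χ₁ v z) :
    AreIsomorphicRep
      ((show Representation ℂ (localPi L (IsCMField.complexConj L) n' (Matrix.reindex e₁ e₁ (Matrix.diagonal dV ⊗ₖ JW (↥(maximalRealSubfield L)) L ε)) v) _ from
        TwistedCoinv.rep (localCharOfCenter (↥(maximalRealSubfield L)) L (IsCMField.complexConj L)
            (JW (↥(maximalRealSubfield L)) L ε) (JW_apply_ne_zero (↥(maximalRealSubfield L)) L ε) χ₁ v)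
          ((OmegaChiSplitting.chiLocalSplittingsD ⟨L⟩ e₁ dV hdV hdV0 θ hθ ε).omegaLoc v)
          (commute_omegaLoc_localCenter (↥(maximalRealSubfield L)) L (IsCMField.complexConj L) 3 e₁ (Matrix.diagonal dV)
            (JW (↥(maximalRealSubfield L)) L ε) (complexConj_imagUnit L) (imagUnit_ne_zero L) (imagUnit_mul_self L)
            (realDiagonal_isSymm L dV hdV) (isSymm_TW (↥(maximalRealSubfield L)) ε) (realDiagonal_map L dV hdV).symm
            (JW_eq (↥(maximalRealSubfield L)) L ε) (JW_apply_ne_zero (↥(maximalRealSubfield L)) L ε)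
            (OmegaChiSplitting.chiLocalSplittingsD ⟨L⟩ e₁ dV hdV hdV0 θ hθ ε) v)).comp
        (localPiSplitEquiv (IsCMField.complexConj L) (Matrix.reindex e₁ e₁ (Matrix.diagonal dV ⊗ₖ JW (↥(maximalRealSubfield L)) L ε))
          hc1 hJh w hw hJw).symm.toMonoidHom)
      (Representation.parabolicIndGL ((w : HeightOneSpectrum (𝓞 L)).adicCompletion L) (Zelevinsky1980.lastBlockLabel n')
        ((Representation.trivial ℂ (Π a : Bool, GL {i : Fin n' // Zelevinsky1980.lastBlockLabel n' i = a}
            ((w : HeightOneSpectrum (𝓞 L)).adicCompletion L)) ℂ).twist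
          (Zelevinsky1980.maxParabolicLeviChar ((w : HeightOneSpectrum (𝓞 L)).adicCompletion L) n'
            (θ.localComponent (w : HeightOneSpectrum (𝓞 L)))
            (χ' * (θ.localComponent (w : HeightOneSpectrum (𝓞 L))) ^ (1 - (n' : ℤ)))))) := by
  letI : MeasurableSpace (v.adicCompletion (↥(maximalRealSubfield L))) := borel _
  haveI : BorelSpace (v.adicCompletion (↥(maximalRealSubfield L))) := ⟨rfl⟩
  have hs := chiLocalSplittingsD_s L e₁ dV hdV hdV0 θ hθ ε v
  exact (splitPlace_chiCoinv_iso_parabolicIndGL_undoubleLoc_localSplittingDatumQuadExt (↥(maximalRealSubfield L)) L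
    (IsCMField.complexConj L) hc1 n' hn (imagUnit L) (complexConj_imagUnit L) (imagUnit_ne_zero L) _ (imagUnit_mul_self L)
    (gram ↥(maximalRealSubfield L) e₁ (realDiagonal L dV hdV) (TW ↥(maximalRealSubfield L) ε))
    (isSymm_gram ↥(maximalRealSubfield L) e₁ (realDiagonal_isSymm L dV hdV) (isSymm_TW ↥(maximalRealSubfield L) ε))
    (isUnit_det_gram ↥(maximalRealSubfield L) e₁ (isUnit_det_realDiagonal L dV hdV hdV0) (isUnit_det_TW ↥(maximalRealSubfield L) ε))
    _ (Summit.HodgeConjecture.HodgeConjecture.Cruxes.H413.F0P2gStubNSIOfCore.gram_realDiagonal_TW_eq_diagonal L e₁ dV hdV ε)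
    (Matrix.reindex e₁ e₁ (Matrix.diagonal dV ⊗ₖ JW (↥(maximalRealSubfield L)) L ε))
    (reindex_kronecker_eq_gram_map ↥(maximalRealSubfield L) L e₁ (realDiagonal_map L dV hdV).symm (JW_eq ↥(maximalRealSubfield L) L ε))
    hJh rfl v w hw hJw Measure.addHaar θ ((isSplittingChar_iff_isSplittingCharExt L 1 θ).1 hθ) hθu
    ((OmegaChiSplitting.chiLocalSplittingsD ⟨L⟩ e₁ dV hdV hdV0 θ hθ ε).s v) (by rw [hs]; rfl)
    (JW (↥(maximalRealSubfield L)) L ε) (JW_apply_ne_zero (↥(maximalRealSubfield L)) L ε)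
    (localCharOfCenter (↥(maximalRealSubfield L)) L (IsCMField.complexConj L) (JW (↥(maximalRealSubfield L)) L ε)
      (JW_apply_ne_zero (↥(maximalRealSubfield L)) L ε) χ₁ v)
    (norm_localCharOfCenter (↥(maximalRealSubfield L)) L (IsCMField.complexConj L) (JW (↥(maximalRealSubfield L)) L ε)
      (JW_apply_ne_zero (↥(maximalRealSubfield L)) L ε) hχ₁u v)
    (continuous_coe_localCharOfCenter (↥(maximalRealSubfield L)) L (IsCMField.complexConj L) (JW (↥(maximalRealSubfield L)) L ε)
      (JW_apply_ne_zero (↥(maximalRealSubfield L)) L ε) hχ₁c v)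
    χ' hχ').2

end Summit.HodgeConjecture.HodgeConjecture.Cruxes.H413.F0P2iXvSplitModel

end
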